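import Summits.CriticalPhenomena.SAWScalingLimit.Theses.SAWBrickWallHomotopy
import Summits.CriticalPhenomena.SAWScalingLimit.Theorems.SAWBrickWallHomotopyModulusUniversalityAffineTransport
import Summits.CriticalPhenomena.SAWScalingLimit.Theorems.ObservableToSLE.Negative.CompactContainer
import Summits.CriticalPhenomena.SAWScalingLimit.Theorems.SAWMassiveIsingTiltHexEndpointApproxExists
import Literature.Probability.RandomPlanarGeometry.SAWBrickWallHex
import HarnessLib

/-!
# `ModulusUniversality`, line `birth`: stub L (`stub_jitteredLipMerging`) — provable layers

Work file of the stub-worker for the registered stub L of the line `birth` / `registered` for the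
crux `SAWBrickWallHomotopy.ModulusUniversality` (stmt-CriticalPhenomena-5790).  The stub itself
(bounded-Lipschitz merging of the straight and the jittered brick-wall laws) is NOT proved here
(verdict `stub-blocked`, see `stub_jitteredLipMerging.md`); this file kernel-checks the provable
layers of its proof architecture and the reduction of L to ONE residual estimate:

* (i) `JitteredBW.site / vertex / equiv / iso` — the POSITION-COMPATIBLE identification of the
  honeycomb lattice with the brick wall: `(x, k) ↦ (2x₀ + x₁ + k + 1, x₁)` is a graph isomorphism
  `hexGraph ≃g SAW.brickWallGraph` under which the jittered embedding `B ∘ hexCenter`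
  (`B = diag(2, 2/√3)`) sits exactly `(k+1)/3 ∈ {1/3, 2/3}` above the brick-wall site
  (`JitteredBW.affinity_hexCenter`, `JitteredBW.dist_meshPoint_site_le`).  (The tree's
  `SAW.bwIso` is a DIFFERENT isomorphism, not position-compatible.)
* (ii) the DRAWING COUPLING: for one abstract walk the straight and the jittered polylines are at
  `CurveClass` distance `≤ 2|δ|/3` (`JitteredBW.dist_mk_polyline_straight_jittered_le`,
  `JitteredBW.dist_toCurve_straight_jittered_le`), so an `L`-Lipschitz test function separates
  them by `≤ L · 2|δ|/3` (`JitteredBW.abs_sub_le_of_lipschitz_straight_jittered`).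
* (iii) the RESTRICTION-PROPERTY total-variation bound for two normalised restrictions `μ[|s]`,
  `μ[|t]` of one measure: `|μ[|s] F - μ[|t] F| ≤ μ[|s] tᶜ + μ[|t] sᶜ`
  (`Restriction.abs_measureReal_cond_sub_le`).
* (iv) Lévy–Prokhorov closeness implies bounded-Lipschitz merging, quantitatively
  (`LPMerging.abs_integral_sub_integral_le_of_levyProkhorovEDist_lt`:
  `|∫ g dμ - ∫ g dν| ≤ (L + 2‖g‖) ε` when `d_LP(μ, ν) < ε`) and along a filter
  (`LPMerging.tendsto_integral_sub_integral`); the residual estimate in Lévy–Prokhorov form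
  `JitteredLPMerging` (∃ form) / `JitteredEndpointCoupling` (∀ form, twin of
  `SAWCircleScreening.EndpointCoupling`, stmt-5465) and the kernel-checked reductions
  `stub_jitteredLipMerging_of_lpMerging : JitteredLPMerging → L` (L verbatim),
  `lpMerging_of_endpointCoupling`, `stub_jitteredLipMerging_of_endpointCoupling`.
* (audit) `exists_isEmbEndpointApprox_jittered` — jittered endpoint approximations exist for every
  Dobrushin domain (the `∃ a' b'` of L is never vacuously false).
* (v) `t = 0` dictionary: the straight law gives no mass to walks with an odd vertical bond and its
  massive walks are walks of `discreteDomainGraph ⊓ brickWallGraph`.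
* (vi) the genuinely missing lattice estimates as `Prop`s over tree vocabulary (`MiddleCoupling`,
  `disputedSite`, `DisputedCollarNonHitting`) — stated, never asserted.
-/

noncomputable section

open MeasureTheory Filter Topology
open scoped NNReal ENNReal
open Literature.Probability.LatticeModels
open Literature.Probability.RandomPlanarGeometry

namespace Summit.CriticalPhenomena.SAWScalingLimit.Cruxes.ModulusUniversality.Birth

namespace JitteredBW

/-! ### (i) The position-compatible isomorphism `hexGraph ≃g brickWallGraph` -/

/-- The brick-wall site UNDER the jittered honeycomb vertex `(x, k)`: `(2x₀ + x₁ + k + 1, x₁)`.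
[folklore] -/
def site (v : HexVertex) : Site 2 :=
  ![2 * v.1 0 + v.1 1 + ((v.2 : ℕ) : ℤ) + 1, v.1 1]

/-- First coordinate of `site`. [folklore] -/
@[simp] theorem site_apply_zero (v : HexVertex) :
    site v 0 = 2 * v.1 0 + v.1 1 + ((v.2 : ℕ) : ℤ) + 1 := rfl

/-- Second coordinate of `site`. [folklore] -/
@[simp] theorem site_apply_one (v : HexVertex) : site v 1 = v.1 1 := by
  simp [site]

/-- The honeycomb vertex OVER the brick-wall site `(m, n)`: the down triangle (type `1`) of the
cell `((m - n - 2)/2, n)` if `m + n` is even, the up triangle (type `0`) of the cell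
`((m - n - 1)/2, n)` if `m + n` is odd. [folklore] -/
def vertex (x : Site 2) : HexVertex :=
  if (x 0 + x 1) % 2 = 0 then (![(x 0 - x 1 - 2) / 2, x 1], 1) else (![(x 0 - x 1 - 1) / 2, x 1], 0)

/-- `vertex` is a left inverse of `site`. [folklore] -/
theorem vertex_site (v : HexVertex) : vertex (site v) = v := by
  obtain ⟨x, k⟩ := v
  have hk : k = 0 ∨ k = 1 := by
    rcases Fin.exists_fin_two.1 ⟨k, rfl⟩ with h | h
    · exact Or.inl h
    · exact Or.inr h
  rcases hk with rfl | rfl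
  · have h : ¬ (site (x, (0 : Fin 2)) 0 + site (x, (0 : Fin 2)) 1) % 2 = 0 := by
      rw [site_apply_zero, site_apply_one]
      simp only [Fin.val_zero, Nat.cast_zero]
      omega
    rw [vertex, if_neg h]
    refine Prod.ext ?_ rfl
    rw [SAW.site_two_eq_iff]
    simp only [site_apply_zero, site_apply_one, Matrix.cons_val_zero, Matrix.cons_val_one,
      Fin.val_zero, Nat.cast_zero, and_true]
    omega
  · have h : (site (x, (1 : Fin 2)) 0 + site (x, (1 : Fin 2)) 1) % 2 = 0 := by
      rw [site_apply_zero, site_apply_one]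
      simp only [Fin.val_one, Nat.cast_one]
      omega
    rw [vertex, if_pos h]
    refine Prod.ext ?_ rfl
    rw [SAW.site_two_eq_iff]
    simp only [site_apply_zero, site_apply_one, Matrix.cons_val_zero, Matrix.cons_val_one,
      Fin.val_one, Nat.cast_one, and_true]
    omega

/-- `site` is a left inverse of `vertex`. [folklore] -/
theorem site_vertex (x : Site 2) : site (vertex x) = x := by
  unfold vertex
  rw [SAW.site_two_eq_iff]
  by_cases h : (x 0 + x 1) % 2 = 0
  · rw [if_pos h, site_apply_zero, site_apply_one]
    simp only [Fin.isValue, Matrix.cons_val_zero, Matrix.cons_val_one, Fin.val_one,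
      Nat.cast_one, and_true]
    omega
  · rw [if_neg h, site_apply_zero, site_apply_one]
    simp only [Fin.isValue, Matrix.cons_val_zero, Matrix.cons_val_one, Fin.val_zero,
      Nat.cast_zero, and_true]
    omega

/-- The bijection `HexVertex ≃ Site 2` under the jittered drawing. [folklore] -/
def equiv : HexVertex ≃ Site 2 where
  toFun := site
  invFun := vertex
  left_inv := vertex_site
  right_inv := site_vertex

/-- Honeycomb adjacency is brick-wall adjacency of the underlying sites. [folklore] -/
theorem hexGraph_adj_iff_brickWall_adj (u v : HexVertex) :
    hexGraph.Adj u v ↔ SAW.brickWallGraph.Adj (site u) (site v) := by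
  obtain ⟨x, i⟩ := u
  obtain ⟨y, j⟩ := v
  rw [SAW.hexGraph_adj_iff_coord, SAW.brickWallGraph_adj_coord]
  simp only [site_apply_zero, site_apply_one]
  fin_cases i <;> fin_cases j <;> simp <;> omega

/-- **The jittered brick wall**: the position-compatible graph isomorphism
`hexGraph ≃g brickWallGraph`, `(x, k) ↦ (2x₀ + x₁ + k + 1, x₁)`. [folklore] -/
def iso : hexGraph ≃g SAW.brickWallGraph where
  toEquiv := equiv
  map_rel_iff' := fun {u v} => (hexGraph_adj_iff_brickWall_adj u v).symm

/-- `iso` is `site` on vertices. [folklore] -/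
@[simp] theorem iso_apply (v : HexVertex) : iso v = site v := rfl

/-- `iso.symm` is `vertex` on sites. [folklore] -/
@[simp] theorem iso_symm_apply (x : Site 2) : iso.symm x = vertex x := rfl

/-! ### (i') Positions: the jittered vertex sits `(k+1)/3` above its brick-wall site -/

/-- Real part of a honeycomb centre: `x₀ + x₁/2 + (k+1)/2`. [folklore] -/
theorem hexCenter_re (v : HexVertex) :
    (hexCenter v).re = v.1 0 + (v.1 1 : ℝ) / 2 + (((v.2 : ℕ) : ℝ) + 1) / 2 := by
  unfold hexCenter triEmbed
  simp only [Complex.add_re, Complex.mul_re, Complex.intCast_re, Complex.intCast_im,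
    triZeta_re, triZeta_im, zero_mul, sub_zero, Complex.div_ofNat_re, Complex.one_re,
    Complex.one_im, Complex.add_im, Complex.natCast_re, Complex.natCast_im]
  ring

/-- Imaginary part of a honeycomb centre: `(√3/2)(x₁ + (k+1)/3)`. [folklore] -/
theorem hexCenter_im (v : HexVertex) :
    (hexCenter v).im = Real.sqrt 3 / 2 * (v.1 1 + (((v.2 : ℕ) : ℝ) + 1) / 3) := by
  unfold hexCenter triEmbed
  simp only [Complex.add_im, Complex.mul_im, Complex.intCast_re, Complex.intCast_im,
    triZeta_re, triZeta_im, zero_mul, add_zero, Complex.div_ofNat_im, Complex.one_re,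
    Complex.one_im, Complex.add_re, Complex.natCast_re, Complex.natCast_im, zero_add]
  ring

/-- **The jittered drawing in brick-wall coordinates**: for the affinity `B = diag(2, 2/√3)`,
`B(c_{(x,k)}) = (2x₀ + x₁ + k + 1) + i (x₁ + (k+1)/3)`, i.e. the brick-wall site `site (x, k)`
displaced vertically by `(k+1)/3`. [folklore] -/
theorem affinity_hexCenter {B : ℂ ≃ₜ ℂ}
    (hB : ∀ z : ℂ, B z = ((2 * z.re : ℝ) : ℂ) + ((2 / Real.sqrt 3 * z.im : ℝ) : ℂ) * Complex.I)
    (v : HexVertex) :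
    B (hexCenter v) = Site.toComplex (site v) + (((((v.2 : ℕ) : ℝ) + 1) / 3 : ℝ) : ℂ) * Complex.I := by
  have h3 : Real.sqrt 3 ≠ 0 := (Real.sqrt_pos.2 (by norm_num : (0 : ℝ) < 3)).ne'
  rw [hB, hexCenter_re, hexCenter_im]
  apply Complex.ext
  · simp only [Complex.add_re, Complex.ofReal_re, Complex.mul_re, Complex.ofReal_im,
      Complex.I_re, Complex.I_im, mul_zero, Site.toComplex_re,
      site_apply_zero, Int.cast_add, Int.cast_mul, Int.cast_ofNat, Int.cast_natCast,
      Int.cast_one, add_zero, mul_one, sub_self]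
    ring
  · simp only [Complex.add_im, Complex.ofReal_im, Complex.mul_im, Complex.ofReal_re,
      Complex.I_re, Complex.I_im, mul_zero, mul_one, zero_add, Site.toComplex_im,
      site_apply_one, add_zero]
    field_simp

/-- Hence, at mesh `δ`, the jittered vertex `δ B(c_v)` is the mesh point `δ · site v` displaced by
`δ (k+1)/3 · i`. [folklore] -/
theorem mul_affinity_hexCenter {B : ℂ ≃ₜ ℂ}
    (hB : ∀ z : ℂ, B z = ((2 * z.re : ℝ) : ℂ) + ((2 / Real.sqrt 3 * z.im : ℝ) : ℂ) * Complex.I)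
    (δ : ℝ) (v : HexVertex) :
    (δ : ℂ) * B (hexCenter v) =
      meshPoint δ (site v) + (δ : ℂ) * ((((((v.2 : ℕ) : ℝ) + 1) / 3 : ℝ) : ℂ) * Complex.I) := by
  rw [affinity_hexCenter hB, meshPoint, mul_add]

/-- **The jitter is at most `2δ/3`**: `dist (δ · site v, δ B(c_v)) = |δ| (k+1)/3 ≤ 2|δ|/3`.
[folklore] -/
theorem dist_meshPoint_site_le {B : ℂ ≃ₜ ℂ}
    (hB : ∀ z : ℂ, B z = ((2 * z.re : ℝ) : ℂ) + ((2 / Real.sqrt 3 * z.im : ℝ) : ℂ) * Complex.I)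
    (δ : ℝ) (v : HexVertex) :
    dist (meshPoint δ (site v)) ((δ : ℂ) * B (hexCenter v)) ≤ 2 * |δ| / 3 := by
  rw [mul_affinity_hexCenter hB, dist_eq_norm, sub_add_cancel_left, norm_neg, norm_mul,
    Complex.norm_real, Real.norm_eq_abs, norm_mul, Complex.norm_I, mul_one, Complex.norm_real,
    Real.norm_eq_abs]
  have hk : (((v.2 : ℕ) : ℝ) + 1) / 3 ≤ 2 / 3 := by
    have : ((v.2 : ℕ) : ℝ) ≤ 1 := by
      have h := v.2.isLt
      exact_mod_cast Nat.lt_succ_iff.1 h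
    linarith
  have hk0 : 0 ≤ (((v.2 : ℕ) : ℝ) + 1) / 3 := by positivity
  rw [abs_of_nonneg hk0]
  calc |δ| * ((((v.2 : ℕ) : ℝ) + 1) / 3) ≤ |δ| * (2 / 3) :=
        mul_le_mul_of_nonneg_left hk (abs_nonneg δ)
    _ = 2 * |δ| / 3 := by ring

/-! ### (ii) The drawing coupling: the straight and the jittered polyline of ONE abstract walk -/

open Summit.CriticalPhenomena.SAWScalingLimit.Theorems.ObservableToSLE.Negative
  (dist_polyline_map_le) in
/-- **Drawing coupling.** For one abstract walk (vertex list `l`), the straight polyline through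
the brick-wall mesh points `δ · site w` and the jittered polyline through `δ B(c_w)` are at
`CurveClass` distance `≤ 2|δ|/3`: same number of vertices, corresponding vertices `≤ 2|δ|/3`
apart (`dist_meshPoint_site_le`), and `polyline` parametrises by list position only
(`dist_polyline_map_le`). [folklore] -/
theorem dist_mk_polyline_straight_jittered_le {B : ℂ ≃ₜ ℂ}
    (hB : ∀ z : ℂ, B z = ((2 * z.re : ℝ) : ℂ) + ((2 / Real.sqrt 3 * z.im : ℝ) : ℂ) * Complex.I)
    (δ : ℝ) (l : List HexVertex) :
    dist (CurveClass.mk ⟨polyline (l.map fun w => meshPoint δ (site w))⟩)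
        (CurveClass.mk ⟨polyline (l.map fun w => (δ : ℂ) * B (hexCenter w))⟩) ≤ 2 * |δ| / 3 := by
  rw [CurveClass.dist_mk_mk]
  refine (Curve.dist_le_dist_toContinuousMap _ _).trans ?_
  exact dist_polyline_map_le _ _ (by positivity) l fun v _ => dist_meshPoint_site_le hB δ v

/-- The jittered curve of a walk `p` of any graph on the honeycomb vertices (e.g. the jittered
discrete domain graph `embDomainGraph hexGraph (B ∘ hexCenter) E δ`) is the class of the jittered
polyline through its support; the STRAIGHT drawing of the same abstract walk is the polyline
through the brick-wall mesh points `δ · site` of its support, which is the support of the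
transported walk `p.map` (`SimpleGraph.Walk.support_map`).  The two classes are `≤ 2|δ|/3` apart.
[folklore] -/
theorem dist_toCurve_straight_jittered_le {B : ℂ ≃ₜ ℂ}
    (hB : ∀ z : ℂ, B z = ((2 * z.re : ℝ) : ℂ) + ((2 / Real.sqrt 3 * z.im : ℝ) : ℂ) * Complex.I)
    (δ : ℝ) {G : SimpleGraph HexVertex} {u v : HexVertex} (p : G.Walk u v) :
    dist (CurveClass.mk ⟨polyline ((p.support.map site).map (meshPoint δ))⟩)
        (CurveClass.mk ⟨p.toCurve fun w => (δ : ℂ) * B (hexCenter w)⟩) ≤ 2 * |δ| / 3 := by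
  rw [List.map_map]
  exact dist_mk_polyline_straight_jittered_le hB δ p.support

/-- **On an `L`-Lipschitz test function the jitter costs at most `L · 2|δ|/3`.** [folklore] -/
theorem abs_sub_le_of_lipschitz_straight_jittered {B : ℂ ≃ₜ ℂ}
    (hB : ∀ z : ℂ, B z = ((2 * z.re : ℝ) : ℂ) + ((2 / Real.sqrt 3 * z.im : ℝ) : ℂ) * Complex.I)
    (δ : ℝ) (l : List HexVertex) {g : CurveClass ℂ → ℝ} {L : ℝ≥0} (hg : LipschitzWith L g) :
    |g (CurveClass.mk ⟨polyline (l.map fun w => meshPoint δ (site w))⟩) -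
        g (CurveClass.mk ⟨polyline (l.map fun w => (δ : ℂ) * B (hexCenter w))⟩)| ≤
      L * (2 * |δ| / 3) := by
  rw [← Real.dist_eq]
  exact (hg.dist_le_mul _ _).trans
    (mul_le_mul_of_nonneg_left (dist_mk_polyline_straight_jittered_le hB δ l) L.2)

end JitteredBW

/-! ### (iii) The restriction-property total-variation bound

By the restriction property of the SAW measure (`EmbSAWRestrictionCovariance.lean`: the law of
the small domain is the law of the big one CONDITIONED to stay in the small domain), the straight
and the jittered laws with MATCHED abstract endpoints are two normalised restrictions `μ[|s]`,
`μ[|t]` of ONE weight measure `μ` on abstract walks (`s`, `t` = "is a walk of `G₁`", "of `G₂`").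
For such a pair, total variation is controlled by the two escape probabilities. -/

namespace Restriction

/-- The real-variable core: `(m + a₁)/S - (m + b₁)/T ≤ (S - c)/S + (T - c)/T` for
`0 ≤ m ≤ c ≤ min S T`, `a₁ ≤ S - c`, `0 ≤ b₁`. [folklore] -/
theorem div_sub_div_le {S T m a₁ b₁ c : ℝ} (hS : 0 < S) (hT : 0 < T) (hm0 : 0 ≤ m)
    (hmc : m ≤ c) (ha : a₁ ≤ S - c) (hb0 : 0 ≤ b₁) (hcS : c ≤ S) (hcT : c ≤ T) :
    (m + a₁) / S - (m + b₁) / T ≤ (S - c) / S + (T - c) / T := by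
  have h1 : m * (1 / S - 1 / T) ≤ (T - c) / T := by
    rcases le_or_gt (1 / S) (1 / T) with h | h
    · calc m * (1 / S - 1 / T) ≤ 0 := mul_nonpos_of_nonneg_of_nonpos hm0 (by linarith)
        _ ≤ (T - c) / T := div_nonneg (by linarith) hT.le
    · have hcS' : c / S ≤ 1 := by
        rw [div_le_one hS]
        exact hcS
      calc m * (1 / S - 1 / T) ≤ c * (1 / S - 1 / T) :=
            mul_le_mul_of_nonneg_right hmc (by linarith)
        _ = c / S - c / T := by ring
        _ ≤ 1 - c / T := by linarith
        _ = (T - c) / T := by field_simp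
  have h2 : a₁ / S ≤ (S - c) / S := div_le_div_of_nonneg_right ha hS.le
  have h3 : 0 ≤ b₁ / T := div_nonneg hb0 hT.le
  have e : (m + a₁) / S - (m + b₁) / T = m * (1 / S - 1 / T) + a₁ / S - b₁ / T := by ring
  rw [e]
  linarith

/-- Two-sided form of `div_sub_div_le`. [folklore] -/
theorem abs_div_sub_div_le {S T m a₁ b₁ c : ℝ} (hS : 0 < S) (hT : 0 < T) (hm0 : 0 ≤ m)
    (hmc : m ≤ c) (ha0 : 0 ≤ a₁) (ha : a₁ ≤ S - c) (hb0 : 0 ≤ b₁) (hb : b₁ ≤ T - c) :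
    |(m + a₁) / S - (m + b₁) / T| ≤ (S - c) / S + (T - c) / T := by
  have hcT : c ≤ T := by linarith
  have hcS : c ≤ S := by linarith
  rw [abs_le]
  constructor
  · have h := div_sub_div_le hT hS hm0 hmc hb ha0 hcT hcS
    linarith
  · exact div_sub_div_le hS hT hm0 hmc ha hb0 hcS hcT

open ProbabilityTheory in
/-- **Total variation between two normalised restrictions of one measure.** For a measure `μ` and
(measurable) sets `s`, `t` of finite nonzero mass, the conditioned measures `μ[|s]`, `μ[|t]`
differ on every set `F` (no measurability needed) by at most `μ[|s] (tᶜ) + μ[|t] (sᶜ)` — for the SAW: the probability that the `G₁`-walk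
leaves `G₂` plus the probability that the `G₂`-walk leaves `G₁`. [folklore] -/
theorem abs_measureReal_cond_sub_le {α : Type*} [MeasurableSpace α] (μ : Measure α)
    {s t : Set α} (hs : MeasurableSet s) (ht : MeasurableSet t) (hs0 : μ s ≠ 0)
    (hs1 : μ s ≠ ∞) (ht0 : μ t ≠ 0) (ht1 : μ t ≠ ∞) (F : Set α) :
    |(μ[|s]).real F - (μ[|t]).real F| ≤ (μ[|s]).real tᶜ + (μ[|t]).real sᶜ := by
  have hS : 0 < μ.real s := ENNReal.toReal_pos hs0 hs1
  have hT : 0 < μ.real t := ENNReal.toReal_pos ht0 ht1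
  have hcond : ∀ {u : Set α}, MeasurableSet u → ∀ G : Set α,
      (μ[|u]).real G = μ.real (u ∩ G) / μ.real u := by
    intro u hu G
    rw [measureReal_def, cond_apply hu μ G, ENNReal.toReal_mul, ENNReal.toReal_inv,
      measureReal_def, measureReal_def, div_eq_inv_mul]
  rw [hcond hs, hcond hs, hcond ht, hcond ht]
  -- finiteness of the pieces
  have hsF : μ (s ∩ F) ≠ ∞ := measure_ne_top_of_subset Set.inter_subset_left hs1
  have htF : μ (t ∩ F) ≠ ∞ := measure_ne_top_of_subset Set.inter_subset_left ht1
  -- decompositions along the other set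
  have d1 : μ.real (s ∩ F ∩ t) + μ.real ((s ∩ F) \ t) = μ.real (s ∩ F) :=
    measureReal_inter_add_sdiff ht hsF
  have d2 : μ.real (t ∩ F ∩ s) + μ.real ((t ∩ F) \ s) = μ.real (t ∩ F) :=
    measureReal_inter_add_sdiff hs htF
  have d3 : μ.real (s ∩ t) + μ.real (s \ t) = μ.real s := measureReal_inter_add_sdiff ht hs1
  have d4 : μ.real (t ∩ s) + μ.real (t \ s) = μ.real t := measureReal_inter_add_sdiff hs ht1
  have hm : μ.real (t ∩ F ∩ s) = μ.real (s ∩ F ∩ t) := by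
    congr 1
    ext x
    simp only [Set.mem_inter_iff]
    tauto
  have hc : μ.real (t ∩ s) = μ.real (s ∩ t) := by rw [Set.inter_comm]
  have htc : μ.real (s ∩ tᶜ) = μ.real s - μ.real (s ∩ t) := by
    rw [← Set.sdiff_eq]
    linarith
  have hsc : μ.real (t ∩ sᶜ) = μ.real t - μ.real (s ∩ t) := by
    rw [← Set.sdiff_eq]
    linarith
  rw [← d1, ← d2, hm, htc, hsc]
  refine abs_div_sub_div_le hS hT measureReal_nonneg ?_ measureReal_nonneg ?_
    measureReal_nonneg ?_
  · exact measureReal_mono (fun x hx => ⟨hx.1.1, hx.2⟩)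
      (measure_ne_top_of_subset Set.inter_subset_left hs1)
  · have h : μ.real ((s ∩ F) \ t) ≤ μ.real (s \ t) :=
      measureReal_mono (Set.sdiff_subset_sdiff_left Set.inter_subset_left)
        (measure_ne_top_of_subset Set.sdiff_subset hs1)
    linarith
  · have h : μ.real ((t ∩ F) \ s) ≤ μ.real (t \ s) :=
      measureReal_mono (Set.sdiff_subset_sdiff_left Set.inter_subset_left)
        (measure_ne_top_of_subset Set.sdiff_subset ht1)
    linarith

end Restriction

/-! ### (iv-a) Lévy–Prokhorov closeness gives bounded-Lipschitz merging (abstract) -/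

namespace LPMerging

open Set

variable {X : Type*} [MeasurableSpace X] [PseudoMetricSpace X] [OpensMeasurableSpace X]

omit [MeasurableSpace X] [OpensMeasurableSpace X] in
/-- Thickening a superlevel set of an `L`-Lipschitz function by `ε` lowers the level by at most
`L ε`. [folklore] -/
theorem thickening_setOf_le_subset {f : X → ℝ} {L : ℝ≥0} (hf : LipschitzWith L f) (ε t : ℝ) :
    Metric.thickening ε {a | t ≤ f a} ⊆ {a | t - L * ε ≤ f a} := by
  intro x hx
  rw [Metric.mem_thickening_iff] at hx
  obtain ⟨y, hy, hxy⟩ := hx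
  have h := hf.dist_le_mul x y
  rw [Real.dist_eq] at h
  have h1 : f y - f x ≤ |f x - f y| := by
    rw [abs_sub_comm]
    exact le_abs_self _
  have h2 : (L : ℝ) * dist x y ≤ L * ε := mul_le_mul_of_nonneg_left hxy.le L.2
  have hy' : t ≤ f y := hy
  show t - L * ε ≤ f x
  linarith

/-- **One-sided Lipschitz–Lévy–Prokhorov bound.** If `d_LP(μ, ν) < ε` then for a nonnegative
bounded `L`-Lipschitz `f`: `∫ f dμ ≤ ∫ f dν + L ε ν(X) + ε ‖f‖` (Mathlib's layer-cake bound
`integral_le_of_levyProkhorovEDist_lt`, the Lipschitz shift of superlevel sets, and the change of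
variables `t ↦ t - Lε` in the layer-cake integral). [folklore] -/
theorem integral_le_integral_add_of_levyProkhorovEDist_lt (μ ν : Measure X) [IsFiniteMeasure μ]
    [IsFiniteMeasure ν] {ε : ℝ} (hε : 0 < ε) (hμν : levyProkhorovEDist μ ν < ENNReal.ofReal ε)
    (f : BoundedContinuousFunction X ℝ) (hf0 : ∀ x, 0 ≤ f x) {L : ℝ≥0}
    (hf : LipschitzWith L f) :
    ∫ x, f x ∂μ ≤ (∫ x, f x ∂ν) + L * ε * ν.real Set.univ + ε * ‖f‖ := by
  set φ : ℝ → ℝ := fun t => ν.real {a | t ≤ f a} with hφ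
  have hφanti : Antitone φ := fun s t hst =>
    measureReal_mono (fun a (ha : t ≤ f a) => hst.trans ha)
  have hφnn : ∀ t, 0 ≤ φ t := fun t => measureReal_nonneg
  have hφle : ∀ t, φ t ≤ ν.real Set.univ := fun t => measureReal_mono (Set.subset_univ _)
  have hf0' : 0 ≤ᵐ[μ] (f : X → ℝ) := Eventually.of_forall hf0
  have hf0'' : 0 ≤ᵐ[ν] (f : X → ℝ) := Eventually.of_forall hf0
  -- Mathlib's layer-cake bound
  have h1 := BoundedContinuousFunction.integral_le_of_levyProkhorovEDist_lt μ ν hε hμν f hf0'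
  -- the thickened superlevel function is antitone as well
  set ψ : ℝ → ℝ := fun t => ν.real (Metric.thickening ε {a | t ≤ f a}) with hψ
  have hψanti : Antitone ψ := fun s t hst =>
    measureReal_mono (Metric.thickening_subset_of_subset ε fun a (ha : t ≤ f a) => hst.trans ha)
  have hM : 0 ≤ ‖f‖ := norm_nonneg _
  have hLε : 0 ≤ (L : ℝ) * ε := by positivity
  -- pointwise comparison and integration over `(0, ‖f‖]`
  have h2 : ∀ t, ψ t ≤ φ (t - L * ε) := fun t =>
    measureReal_mono (thickening_setOf_le_subset hf ε t)
  have hshift : Antitone fun t => φ (t - L * ε) := fun s t hst => hφanti (by linarith)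
  have h3 : ∫ t in Ioc 0 ‖f‖, ψ t ≤ ∫ t in Ioc 0 ‖f‖, φ (t - L * ε) :=
    setIntegral_mono_on (hψanti.intervalIntegrable (a := 0) (b := ‖f‖)).1
      (hshift.intervalIntegrable (a := 0) (b := ‖f‖)).1 measurableSet_Ioc fun t _ => h2 t
  -- change of variables and splitting off `[-Lε, 0]`
  have h4 : ∫ t in Ioc 0 ‖f‖, φ (t - L * ε) ≤ L * ε * ν.real Set.univ + ∫ t in Ioc 0 ‖f‖, φ t := by
    rw [← intervalIntegral.integral_of_le hM, ← intervalIntegral.integral_of_le hM,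
      intervalIntegral.integral_comp_sub_right (fun t => φ t) ((L : ℝ) * ε)]
    have hsplit : ∫ t in (0 - L * ε)..‖f‖, φ t =
        (∫ t in (0 - L * ε)..0, φ t) + ∫ t in (0 : ℝ)..‖f‖, φ t :=
      (intervalIntegral.integral_add_adjacent_intervals hφanti.intervalIntegrable
        hφanti.intervalIntegrable).symm
    have hhead : ∫ t in (0 - L * ε)..0, φ t ≤ L * ε * ν.real Set.univ := by
      have h := intervalIntegral.norm_integral_le_of_norm_le_const (a := 0 - L * ε) (b := 0)
        (C := ν.real Set.univ) (f := φ) fun t _ => by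
          rw [Real.norm_of_nonneg (hφnn t)]
          exact hφle t
      rw [Real.norm_eq_abs] at h
      have h' : |(0 : ℝ) - (0 - L * ε)| = L * ε := by
        rw [sub_sub_cancel, abs_of_nonneg hLε]
      rw [h'] at h
      calc ∫ t in (0 - L * ε)..0, φ t ≤ |∫ t in (0 - L * ε)..0, φ t| := le_abs_self _
        _ ≤ ν.real Set.univ * (L * ε) := h
        _ = L * ε * ν.real Set.univ := by ring
    calc ∫ t in (0 - L * ε)..(‖f‖ - L * ε), φ t
        ≤ ∫ t in (0 - L * ε)..‖f‖, φ t :=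
          intervalIntegral.integral_mono_interval le_rfl (by linarith) (by linarith)
            (Eventually.of_forall fun t => hφnn t) hφanti.intervalIntegrable
      _ = (∫ t in (0 - L * ε)..0, φ t) + ∫ t in (0 : ℝ)..‖f‖, φ t := hsplit
      _ ≤ L * ε * ν.real Set.univ + ∫ t in (0 : ℝ)..‖f‖, φ t := add_le_add hhead le_rfl
  -- layer cake for `ν`
  have h5 : ∫ t in Ioc 0 ‖f‖, φ t = ∫ x, f x ∂ν :=
    (BoundedContinuousFunction.integral_eq_integral_meas_le f ν hf0'').symm
  linarith [h1, h3, h4, h5]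

/-- **Lipschitz–Lévy–Prokhorov bound** for probability measures: if `d_LP(μ, ν) < ε` then for every
bounded `L`-Lipschitz `g`, `|∫ g dμ - ∫ g dν| ≤ (L + 2‖g‖) ε` (apply the one-sided bound to
`g + ‖g‖ ≥ 0` in both directions). [folklore] -/
theorem abs_integral_sub_integral_le_of_levyProkhorovEDist_lt (μ ν : Measure X)
    [IsProbabilityMeasure μ] [IsProbabilityMeasure ν] {ε : ℝ} (hε : 0 < ε)
    (hμν : levyProkhorovEDist μ ν < ENNReal.ofReal ε) (g : BoundedContinuousFunction X ℝ)
    {L : ℝ≥0} (hg : LipschitzWith L g) :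
    |(∫ x, g x ∂μ) - ∫ x, g x ∂ν| ≤ (L + 2 * ‖g‖) * ε := by
  obtain ⟨f, hfx⟩ : ∃ f : BoundedContinuousFunction X ℝ, ∀ x, f x = g x + ‖g‖ :=
    ⟨g + BoundedContinuousFunction.const X ‖g‖, fun x => rfl⟩
  have hf0 : ∀ x, 0 ≤ f x := fun x => by
    rw [hfx]
    have h := (abs_le.1 (g.norm_coe_le_norm x)).1
    linarith
  have hfL : LipschitzWith L f := LipschitzWith.of_dist_le_mul fun x y => by
    rw [hfx, hfx, dist_add_right]
    exact hg.dist_le_mul x y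
  have hfnorm : ‖f‖ ≤ 2 * ‖g‖ := by
    refine (BoundedContinuousFunction.norm_le (by positivity)).2 fun x => ?_
    rw [hfx, Real.norm_eq_abs]
    have h := abs_le.1 (g.norm_coe_le_norm x)
    rw [abs_le]
    constructor <;> linarith [h.1, h.2, norm_nonneg g]
  have hνμ : levyProkhorovEDist ν μ < ENNReal.ofReal ε := by rwa [levyProkhorovEDist_comm]
  have h1 := integral_le_integral_add_of_levyProkhorovEDist_lt μ ν hε hμν f hf0 hfL
  have h2 := integral_le_integral_add_of_levyProkhorovEDist_lt ν μ hε hνμ f hf0 hfL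
  have hintμ : ∫ x, f x ∂μ = (∫ x, g x ∂μ) + ‖g‖ := by
    simp_rw [hfx]
    rw [integral_add (g.integrable μ) (integrable_const _), integral_const, smul_eq_mul,
      probReal_univ, one_mul]
  have hintν : ∫ x, f x ∂ν = (∫ x, g x ∂ν) + ‖g‖ := by
    simp_rw [hfx]
    rw [integral_add (g.integrable ν) (integrable_const _), integral_const, smul_eq_mul,
      probReal_univ, one_mul]
  rw [hintμ, hintν, probReal_univ] at h1
  rw [hintν, hintμ, probReal_univ] at h2
  have hεf : ε * ‖f‖ ≤ ε * (2 * ‖g‖) := mul_le_mul_of_nonneg_left hfnorm hε.le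
  rw [abs_le]
  constructor
  · nlinarith [h2, hεf]
  · nlinarith [h1, hεf]

/-- **Lévy–Prokhorov merging implies bounded-Lipschitz merging.** Two families of (eventually)
probability measures on a pseudo-metric space whose Lévy–Prokhorov distance tends to `0` merge on
every bounded Lipschitz test function. [folklore] -/
theorem tendsto_integral_sub_integral {ι : Type*} {l : Filter ι} {μ ν : ι → Measure X}
    (hμ : ∀ᶠ i in l, IsProbabilityMeasure (μ i)) (hν : ∀ᶠ i in l, IsProbabilityMeasure (ν i))
    (h : Tendsto (fun i => levyProkhorovDist (μ i) (ν i)) l (𝓝 0))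
    (g : BoundedContinuousFunction X ℝ) {L : ℝ≥0} (hg : LipschitzWith L g) :
    Tendsto (fun i => (∫ x, g x ∂(μ i)) - ∫ x, g x ∂(ν i)) l (𝓝 0) := by
  rw [Metric.tendsto_nhds]
  intro ε' hε'
  have hK : 0 < (L : ℝ) + 2 * ‖g‖ + 1 := by positivity
  set ε : ℝ := ε' / ((L : ℝ) + 2 * ‖g‖ + 1) with hεdef
  have hε : 0 < ε := div_pos hε' hK
  have hev : ∀ᶠ i in l, levyProkhorovDist (μ i) (ν i) < ε := by
    have := Metric.tendsto_nhds.1 h ε hε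
    refine this.mono fun i hi => ?_
    rw [Real.dist_eq, sub_zero, abs_of_nonneg] at hi
    · exact hi
    · exact ENNReal.toReal_nonneg
  filter_upwards [hμ, hν, hev] with i hμi hνi hi
  have hE : levyProkhorovEDist (μ i) (ν i) < ENNReal.ofReal ε := by
    have hne : levyProkhorovEDist (μ i) (ν i) ≠ ∞ := levyProkhorovEDist_ne_top _ _
    rw [← ENNReal.ofReal_toReal hne]
    exact (ENNReal.ofReal_lt_ofReal_iff hε).2 hi
  have hb := abs_integral_sub_integral_le_of_levyProkhorovEDist_lt (μ i) (ν i) hε hE g hg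
  rw [Real.dist_eq, sub_zero]
  calc |(∫ x, g x ∂(μ i)) - ∫ x, g x ∂(ν i)| ≤ (L + 2 * ‖g‖) * ε := hb
    _ < ((L : ℝ) + 2 * ‖g‖ + 1) * ε := by
        exact mul_lt_mul_of_pos_right (by linarith) hε
    _ = ε' := by
        rw [hεdef, mul_div_cancel₀ _ hK.ne']

omit [OpensMeasurableSpace X] in
/-- A probability measure is at Lévy–Prokhorov distance `≥ 1` from the zero measure (so
Lévy–Prokhorov merging with probability measures excludes the junk value `0`). [folklore] -/
theorem one_le_levyProkhorovDist_zero (μ : Measure X) [IsProbabilityMeasure μ] :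
    1 ≤ levyProkhorovDist μ 0 := by
  by_contra h
  rw [not_le] at h
  have hne : levyProkhorovEDist μ 0 ≠ ∞ := levyProkhorovEDist_ne_top _ _
  have hE : levyProkhorovEDist μ 0 < 1 := by
    rw [← ENNReal.ofReal_toReal hne, ← ENNReal.ofReal_one]
    exact (ENNReal.ofReal_lt_ofReal_iff one_pos).2 h
  obtain ⟨c, hc, hc1⟩ := exists_between hE
  have key := left_measure_le_of_levyProkhorovEDist_lt hc (MeasurableSet.univ (α := X))
  simp only [measure_univ, Measure.coe_zero, Pi.zero_apply, zero_add] at key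
  exact absurd (key.trans_lt hc1) (lt_irrefl 1)

end LPMerging

/-! ### (audit) The `∃ a' b'` of stub L is never vacuously false -/

/-- **Jittered endpoint approximations exist for every Dobrushin domain.**  A hexagonal endpoint
approximation of `B⁻¹E = E.map B.symm` (which exists: `HexEndpointApprox.exists_isEmbEndpointApprox`,
"the largest honeycomb component of a Jordan domain is the bulk") IS a jittered-brick-wall endpoint
approximation of `E`: the two `Ω_δ` graphs coincide (`embDomainGraph_affine`, stub T's file) and
`δ B(c) = B(δ c) → B(B⁻¹ pt) = pt`. [folklore] -/
theorem exists_isEmbEndpointApprox_jittered {B : ℂ ≃ₜ ℂ}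
    (hB : ∀ z : ℂ, B z = ((2 * z.re : ℝ) : ℂ) + ((2 / Real.sqrt 3 * z.im : ℝ) : ℂ) * Complex.I)
    (E : DobrushinDomain) :
    ∃ a' b' : ℝ → HexVertex,
      SAW.IsEmbEndpointApprox hexGraph (fun v : HexVertex => B (hexCenter v)) E a' b' := by
  have hBsmul : ∀ (r : ℝ) (z : ℂ), B ((r : ℂ) * z) = (r : ℂ) * B z := by
    intro r z
    simp only [hB]
    apply Complex.ext
    · simp only [Complex.add_re, Complex.mul_re, Complex.mul_im, Complex.ofReal_re,
        Complex.ofReal_im, Complex.I_re, Complex.I_im, Complex.add_im]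
      ring
    · simp only [Complex.add_re, Complex.mul_re, Complex.mul_im, Complex.ofReal_re,
        Complex.ofReal_im, Complex.I_re, Complex.I_im, Complex.add_im]
      ring
  have hBline : ∀ (x y : ℂ) (c : ℝ),
      B (AffineMap.lineMap x y c) = AffineMap.lineMap (B x) (B y) c := by
    intro x y c
    rw [AffineMap.lineMap_apply_module', AffineMap.lineMap_apply_module', Complex.real_smul,
      Complex.real_smul]
    simp only [hB]
    apply Complex.ext
    · simp only [Complex.add_re, Complex.add_im, Complex.sub_re, Complex.sub_im, Complex.mul_re,
        Complex.mul_im, Complex.ofReal_re, Complex.ofReal_im, Complex.I_re, Complex.I_im]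
      ring
    · simp only [Complex.add_re, Complex.add_im, Complex.sub_re, Complex.sub_im, Complex.mul_re,
        Complex.mul_im, Complex.ofReal_re, Complex.ofReal_im, Complex.I_re, Complex.I_im]
      ring
  obtain ⟨a', b', h⟩ :=
    Summit.CriticalPhenomena.SAWScalingLimit.Theorems.HexEndpointApprox.exists_isEmbEndpointApprox
      (E.map B.symm)
  refine ⟨a', b', ⟨?_, ?_, ?_⟩⟩
  · refine h.reachable.mono fun δ hδ => ?_
    rw [← embDomainGraph_affine hexGraph hexCenter B hBsmul hBline E.carrier δ,
      ← MarkedDomain.carrier_map E B.symm]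
    exact hδ
  · have h1 := (B.continuous.tendsto _).comp h.tendsto_fst
    rw [MarkedDomain.pt_map, Homeomorph.apply_symm_apply] at h1
    refine h1.congr fun δ => ?_
    rw [Function.comp_apply, hBsmul]
  · have h1 := (B.continuous.tendsto _).comp h.tendsto_snd
    rw [MarkedDomain.pt_map, Homeomorph.apply_symm_apply] at h1
    refine h1.congr fun δ => ?_
    rw [Function.comp_apply, hBsmul]

/-! ### (iv-b) The residual estimate in Lévy–Prokhorov form, and the reduction of stub L to it -/

/-- Junk dichotomy for the generic SAW law: `embLaw` is the zero measure (total weight `0` or `∞`)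
or a probability measure. [folklore] -/
theorem embLaw_zero_or_prob {V : Type*} (G : SimpleGraph V) (emb : V → ℂ) (Ω : Set ℂ)
    (δ x : ℝ) (a b : V) :
    SAW.embLaw G emb Ω δ x a b = 0 ∨ IsProbabilityMeasure (SAW.embLaw G emb Ω δ x a b) := by
  by_cases h0 : SAW.embWeight G emb Ω δ x a b Set.univ = 0
  · left
    rw [SAW.embLaw, Measure.measure_univ_eq_zero.1 h0, smul_zero]
  by_cases htop : SAW.embWeight G emb Ω δ x a b Set.univ = ∞
  · left
    rw [SAW.embLaw, htop, ENNReal.inv_top, zero_smul]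
  · right
    exact SAW.isProbabilityMeasure_embLaw h0 htop

/-- **(M2-LP) Lévy–Prokhorov merging of the straight and the jittered brick-wall laws** — the
residual estimate behind stub L, in the form of the route `SAWCircleScreening`'s crux
`EndpointCoupling` (stmt-CriticalPhenomena-5465: there ONE lattice convention and two endpoint
approximations; here TWO drawings/discretisation conventions of the brick wall = honeycomb
lattice and an endpoint approximation of our choice on the jittered side): for `B = diag(2, 2/√3)`,
every Dobrushin `E` and every `ℤ²` endpoint approximation along which the straight brick-wall law
(`ℤ²` conventions, `t = 0`) is eventually a probability measure, some jittered endpoint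
approximation makes the Lévy–Prokhorov distance between the two laws pushed to `CurveClass ℂ`
tend to `0`.  Content (see the work note): an `o(1)`-COUPLING of the two critical honeycomb
two-point walks drawn `2δ/3`-close (`JitteredBW.dist_mk_polyline_straight_jittered_le`), i.e.
(M2a) collar non-hitting away from the endpoints + (M2b) insensitivity to the microscopic endpoint
data; by `levyProkhorovEDist_le_of_coupling` (tree) any such coupling gives (M2-LP).  No named
fact of the tree delivers it; OPEN (no boundary estimate for the critical SAW on any lattice).
[status: open] [folklore] -/
def JitteredLPMerging : Prop :=
  ∀ B : ℂ ≃ₜ ℂ,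
    (∀ z : ℂ, B z = ((2 * z.re : ℝ) : ℂ) + ((2 / Real.sqrt 3 * z.im : ℝ) : ℂ) * Complex.I) →
    ∀ (E : DobrushinDomain) (a b : ℝ → Site 2), SAW.IsEndpointApprox E a b →
      (∀ᶠ δ in nhdsWithin 0 (Set.Ioi 0),
        IsProbabilityMeasure (SAW.brickWallLaw E.carrier δ 0 (a δ) (b δ))) →
      ∃ a' b' : ℝ → HexVertex,
        SAW.IsEmbEndpointApprox hexGraph (fun v : HexVertex => B (hexCenter v)) E a' b' ∧
        Tendsto (fun δ => levyProkhorovDist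
            ((SAW.brickWallLaw E.carrier δ 0 (a δ) (b δ)).map (fun γ => γ.curve))
            ((SAW.embLaw hexGraph (fun v : HexVertex => B (hexCenter v)) E.carrier δ
              SAW.hexCriticalFugacity (a' δ) (b' δ)).map (fun γ => γ.curve)))
          (nhdsWithin 0 (Set.Ioi 0)) (nhds 0)

/-- **Reduction of stub L to (M2-LP)** (kernel-checked): Lévy–Prokhorov merging of the two curve
laws implies bounded-Lipschitz merging, i.e. the registered statement of `stub_jitteredLipMerging`
verbatim.  The junk value `0` of the jittered law is excluded because a probability measure is at
Lévy–Prokhorov distance `1` from `0` (`LPMerging.one_le_levyProkhorovDist_zero`); then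
`LPMerging.tendsto_integral_sub_integral` and `integral_map`. [folklore] -/
theorem stub_jitteredLipMerging_of_lpMerging (hLP : JitteredLPMerging) :
    ∀ B : ℂ ≃ₜ ℂ, (∀ z : ℂ, B z = ((2 * z.re : ℝ) : ℂ) + ((2 / Real.sqrt 3 * z.im : ℝ) : ℂ) * Complex.I) → ∀ (E : DobrushinDomain) (a b : ℝ → Site 2), SAW.IsEndpointApprox E a b → (∀ᶠ δ in nhdsWithin 0 (Set.Ioi 0), IsProbabilityMeasure (SAW.brickWallLaw E.carrier δ 0 (a δ) (b δ))) → ∃ a' b' : ℝ → HexVertex, SAW.IsEmbEndpointApprox hexGraph (fun v : HexVertex => B (hexCenter v)) E a' b' ∧ ∀ (g : BoundedContinuousFunction (CurveClass ℂ) ℝ) (L : NNReal), LipschitzWith L g → Tendsto (fun δ => (∫ γ, g γ.curve ∂(SAW.brickWallLaw E.carrier δ 0 (a δ) (b δ))) - ∫ γ, g γ.curve ∂(SAW.embLaw hexGraph (fun v : HexVertex => B (hexCenter v)) E.carrier δ SAW.hexCriticalFugacity (a' δ) (b' δ))) (nhdsWithin 0 (Set.Ioi 0)) (nhds 0) :=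 by
  intro B hB E a b hab hprob
  obtain ⟨a', b', hab', hT⟩ := hLP B hB E a b hab hprob
  refine ⟨a', b', hab', fun g L hg => ?_⟩
  -- the two curve laws on `CurveClass ℂ`
  set μ : ℝ → Measure (CurveClass ℂ) := fun δ =>
    (SAW.brickWallLaw E.carrier δ 0 (a δ) (b δ)).map (fun γ => γ.curve) with hμ
  set ν : ℝ → Measure (CurveClass ℂ) := fun δ =>
    (SAW.embLaw hexGraph (fun v : HexVertex => B (hexCenter v)) E.carrier δ
      SAW.hexCriticalFugacity (a' δ) (b' δ)).map (fun γ => γ.curve) with hν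
  have hμprob : ∀ᶠ δ in nhdsWithin 0 (Set.Ioi 0), IsProbabilityMeasure (μ δ) := by
    filter_upwards [hprob] with δ hδ
    exact Measure.isProbabilityMeasure_map (SAW.DomainSAW.measurable_of_top _).aemeasurable
  -- the jittered law is eventually a probability measure: `d_LP(prob, 0) ≥ 1`
  have hνprob : ∀ᶠ δ in nhdsWithin 0 (Set.Ioi 0), IsProbabilityMeasure (ν δ) := by
    have hev : ∀ᶠ δ in nhdsWithin 0 (Set.Ioi 0), levyProkhorovDist (μ δ) (ν δ) < 1 := by
      have := Metric.tendsto_nhds.1 hT 1 one_pos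
      refine this.mono fun δ hδ => ?_
      rw [Real.dist_eq, sub_zero, abs_of_nonneg] at hδ
      · exact hδ
      · exact ENNReal.toReal_nonneg
    filter_upwards [hμprob, hev] with δ hμδ hδ
    rcases embLaw_zero_or_prob hexGraph (fun v : HexVertex => B (hexCenter v)) E.carrier δ
      SAW.hexCriticalFugacity (a' δ) (b' δ) with h | h
    · exfalso
      have h0 : ν δ = 0 := by
        simp only [hν, h, Measure.map_zero]
      rw [h0] at hδ
      exact absurd (LPMerging.one_le_levyProkhorovDist_zero (μ δ)) (not_le.2 hδ)
    · exact Measure.isProbabilityMeasure_map (SAW.EmbDomainSAW.measurable_of_top _).aemeasurable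
  have key := LPMerging.tendsto_integral_sub_integral hμprob hνprob hT g hg
  refine key.congr fun δ => ?_
  simp only [hμ, hν]
  rw [integral_map (SAW.DomainSAW.measurable_of_top _).aemeasurable
      g.continuous.aestronglyMeasurable,
    integral_map (SAW.EmbDomainSAW.measurable_of_top _).aemeasurable
      g.continuous.aestronglyMeasurable]

/-! ### (iv-c) The `∀`-form (two-convention endpoint coupling) implies (M2-LP) -/

/-- **Two-convention endpoint coupling for the critical brick-wall = honeycomb walk**
(`JitteredEndpointCoupling`): the `∀ (a', b')` strengthening of (M2-LP) — for EVERY `ℤ²` endpoint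
approximation `(a, b)` (straight law eventually a probability measure) and EVERY jittered endpoint
approximation `(a', b')` of the same Dobrushin domain, the Lévy–Prokhorov distance of the two
curve laws tends to `0`.  Literally the twin of `SAWCircleScreening.EndpointCoupling`
(stmt-CriticalPhenomena-5465: `SAW.law`, one convention, two approximations) for the brick-wall law
at `t = 0` across the two drawings; it implies the one-convention brick-wall endpoint coupling
(triangle inequality through a jittered intermediary).  OPEN. [status: open] [folklore] -/
def JitteredEndpointCoupling : Prop :=
  ∀ B : ℂ ≃ₜ ℂ,
    (∀ z : ℂ, B z = ((2 * z.re : ℝ) : ℂ) + ((2 / Real.sqrt 3 * z.im : ℝ) : ℂ) * Complex.I) →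
    ∀ (E : DobrushinDomain) (a b : ℝ → Site 2) (a' b' : ℝ → HexVertex),
      SAW.IsEndpointApprox E a b →
      (∀ᶠ δ in nhdsWithin 0 (Set.Ioi 0),
        IsProbabilityMeasure (SAW.brickWallLaw E.carrier δ 0 (a δ) (b δ))) →
      SAW.IsEmbEndpointApprox hexGraph (fun v : HexVertex => B (hexCenter v)) E a' b' →
        Tendsto (fun δ => levyProkhorovDist
            ((SAW.brickWallLaw E.carrier δ 0 (a δ) (b δ)).map (fun γ => γ.curve))
            ((SAW.embLaw hexGraph (fun v : HexVertex => B (hexCenter v)) E.carrier δ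
              SAW.hexCriticalFugacity (a' δ) (b' δ)).map (fun γ => γ.curve)))
          (nhdsWithin 0 (Set.Ioi 0)) (nhds 0)

/-- The `∀`-form implies (M2-LP): jittered endpoint approximations exist
(`exists_isEmbEndpointApprox_jittered`). [folklore] -/
theorem lpMerging_of_endpointCoupling (h : JitteredEndpointCoupling) : JitteredLPMerging := by
  intro B hB E a b hab hprob
  obtain ⟨a', b', hab'⟩ := exists_isEmbEndpointApprox_jittered hB E
  exact ⟨a', b', hab', h B hB E a b a' b' hab hprob hab'⟩

/-- Hence the `∀`-form implies stub L. [folklore] -/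
theorem stub_jitteredLipMerging_of_endpointCoupling (h : JitteredEndpointCoupling) :
    ∀ B : ℂ ≃ₜ ℂ, (∀ z : ℂ, B z = ((2 * z.re : ℝ) : ℂ) + ((2 / Real.sqrt 3 * z.im : ℝ) : ℂ) * Complex.I) → ∀ (E : DobrushinDomain) (a b : ℝ → Site 2), SAW.IsEndpointApprox E a b → (∀ᶠ δ in nhdsWithin 0 (Set.Ioi 0), IsProbabilityMeasure (SAW.brickWallLaw E.carrier δ 0 (a δ) (b δ))) → ∃ a' b' : ℝ → HexVertex, SAW.IsEmbEndpointApprox hexGraph (fun v : HexVertex => B (hexCenter v)) E a' b' ∧ ∀ (g : BoundedContinuousFunction (CurveClass ℂ) ℝ) (L : NNReal), LipschitzWith L g → Tendsto (fun δ => (∫ γ, g γ.curve ∂(SAW.brickWallLaw E.carrier δ 0 (a δ) (b δ))) - ∫ γ, g γ.curve ∂(SAW.embLaw hexGraph (fun v : HexVertex => B (hexCenter v)) E.carrier δ SAW.hexCriticalFugacity (a' δ) (b' δ))) (nhdsWithin 0 (Set.Ioi 0)) (nhds 0) :=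
  stub_jitteredLipMerging_of_lpMerging (lpMerging_of_endpointCoupling h)

/-! ### (v) Dictionary for the straight side at `t = 0`: the law lives on brick-wall walks -/

/-- At `t = 0` the weight of a single SAW is `x_c(ℍ)^{|γ|}` if it uses no odd vertical bond and
`0` otherwise (`0 ^ 0 = 1`, `x_c(0) = hexCriticalFugacity`). [folklore] -/
theorem brickWallWeight_zero_singleton {Ω : Set ℂ} {δ : ℝ} {a b : Site 2}
    (γ : SAW.DomainSAW Ω δ a b) :
    SAW.brickWallWeight Ω δ 0 a b {γ} =
      if SAW.oddVerticalCount γ.walk = 0 then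
        ENNReal.ofReal (SAW.hexCriticalFugacity ^ γ.length) else 0 := by
  rw [SAW.brickWallWeight_singleton, SAW.criticalFugacityT_zero]
  split_ifs with h
  · rw [h, pow_zero, mul_one]
  · rw [zero_pow h, mul_zero, ENNReal.ofReal_zero]

/-- At `t = 0` the walks using an odd vertical bond (the non-brick-wall walks) carry no mass.
[folklore] -/
theorem brickWallWeight_zero_setOf_oddVerticalCount_ne_zero {Ω : Set ℂ} {δ : ℝ} {a b : Site 2} :
    SAW.brickWallWeight Ω δ 0 a b {γ | SAW.oddVerticalCount γ.walk ≠ 0} = 0 := by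
  rw [SAW.brickWallWeight_apply, ENNReal.tsum_eq_zero]
  intro γ
  by_cases h : SAW.oddVerticalCount γ.walk = 0
  · rw [Set.indicator_of_notMem]
    simpa using h
  · rw [Set.indicator_of_mem (by exact h), SAW.criticalFugacityT_zero, zero_pow h, mul_zero,
      ENNReal.ofReal_zero]

/-- Hence the straight brick-wall LAW at `t = 0` gives no mass to walks with an odd vertical bond:
it is a law on brick-wall (= honeycomb) walks of the `ℤ²` discrete domain. [folklore] -/
theorem brickWallLaw_zero_setOf_oddVerticalCount_ne_zero {Ω : Set ℂ} {δ : ℝ} {a b : Site 2} :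
    SAW.brickWallLaw Ω δ 0 a b {γ | SAW.oddVerticalCount γ.walk ≠ 0} = 0 := by
  rw [SAW.brickWallLaw, Measure.smul_apply, brickWallWeight_zero_setOf_oddVerticalCount_ne_zero,
    smul_zero]

/-- A `t = 0`-massive SAW of the `ℤ²` discrete domain is a walk of the brick wall: all its edges are
brick-wall edges (`SAW.edges_mem_brickWall_of_oddVerticalCount_eq_zero` after transfer to `ℤ²`),
so it transfers to the subgraph `discreteDomainGraph Ω δ ⊓ brickWallGraph` — the graph `G₁` of the
work note. [folklore] -/
theorem edges_mem_inf_brickWall_of_oddVerticalCount_eq_zero {Ω : Set ℂ} {δ : ℝ} {a b : Site 2}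
    (γ : SAW.DomainSAW Ω δ a b) (h : SAW.oddVerticalCount γ.walk = 0) :
    ∀ e ∈ γ.walk.edges, e ∈ (discreteDomainGraph Ω δ ⊓ SAW.brickWallGraph).edgeSet := by
  rw [SAW.oddVerticalCount_eq_zero_iff] at h
  intro e he
  rw [SimpleGraph.Walk.edges, List.mem_map] at he
  obtain ⟨d, hd, rfl⟩ := he
  obtain ⟨⟨x, y⟩, hxy⟩ := d
  refine ⟨hxy, ?_, h _ hd⟩
  exact meshGraph_le_zdGraph Ω δ (discreteDomainGraph_le_meshGraph Ω δ hxy)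

/-- The straight curve of a SAW of `Ω_δ ⊆ δℤ²` is the class of the polyline through the mesh points
of its support (definitional; recorded for the transfer to abstract vertex lists). [folklore] -/
theorem DomainSAW_curve_eq {Ω : Set ℂ} {δ : ℝ} {a b : Site 2} (γ : SAW.DomainSAW Ω δ a b) :
    γ.curve = CurveClass.mk ⟨polyline (γ.walk.support.map (meshPoint δ))⟩ := rfl

/-- The jittered curve of a SAW of the jittered domain is the class of the jittered polyline through
its support (definitional). [folklore] -/
theorem EmbDomainSAW_curve_eq {B : ℂ ≃ₜ ℂ} {Ω : Set ℂ} {δ : ℝ} {a b : HexVertex}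
    (γ : SAW.EmbDomainSAW hexGraph (fun v : HexVertex => B (hexCenter v)) Ω δ a b) :
    γ.curve = CurveClass.mk ⟨polyline (γ.walk.support.map fun w => (δ : ℂ) * B (hexCenter w))⟩ :=
  rfl

/-! ### (vi) The genuinely missing lattice estimates, as `Prop`s over tree vocabulary

Nothing below is asserted; these are the statements a future proof of stub L must supply (see the
work note `stub_jitteredLipMerging.md`, §3–§5).  All junk conventions are those of the tree
(`brickWallLaw` / `embLaw` are `0` when the total weight is `0` or `∞`). -/

/-- **(M2⋆) Middle coupling** — THE residual of stub L as a statement about ABSTRACT walks (no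
curve topology): for every `ρ > 0` and all small `δ`, the straight law (`ℤ²` conventions, `t = 0`)
and the jittered law (honeycomb conventions) — read on brick-wall SITES through
`JitteredBW.site` — admit a coupling under which, off an event of probability `≤ ρ`, the two
vertex lists share a common middle block `m`, the prefixes lying in the `ρ`-ball at `pt 0` and
the suffixes in the `ρ`-ball at `pt 1`.  With the drawing coupling (ii), a concatenation lemma in
`CurveClass ℂ` (not formalised) and `levyProkhorovEDist_le_of_coupling` (tree) it gives
`JitteredEndpointCoupling`, hence (M2-LP), hence L.  Heuristic content: (M2a) the critical
honeycomb two-point walk does not touch the disputed `o(1)`-collar of `∂E` away from its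
endpoints; (M2b) its law away from the endpoints forgets the microscopic endpoint data
(quasi-multiplicativity at the boundary; kin `SAWCircleScreening.EndpointCoupling`, stmt-5465, and
its tame inputs `ScreenOverlap` stmt-5463, `NoDeepReturn` stmt-5464).  OPEN. [status: open]
[folklore] -/
def MiddleCoupling : Prop :=
  ∀ B : ℂ ≃ₜ ℂ,
    (∀ z : ℂ, B z = ((2 * z.re : ℝ) : ℂ) + ((2 / Real.sqrt 3 * z.im : ℝ) : ℂ) * Complex.I) →
    ∀ (E : DobrushinDomain) (a b : ℝ → Site 2) (a' b' : ℝ → HexVertex),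
      SAW.IsEndpointApprox E a b →
      (∀ᶠ δ in nhdsWithin 0 (Set.Ioi 0),
        IsProbabilityMeasure (SAW.brickWallLaw E.carrier δ 0 (a δ) (b δ))) →
      SAW.IsEmbEndpointApprox hexGraph (fun v : HexVertex => B (hexCenter v)) E a' b' →
      ∀ ρ : ℝ, 0 < ρ → ∀ᶠ δ in nhdsWithin 0 (Set.Ioi 0),
        ∃ Q : Measure (SAW.DomainSAW E.carrier δ (a δ) (b δ) ×
            SAW.EmbDomainSAW hexGraph (fun v : HexVertex => B (hexCenter v)) E.carrier δ
              (a' δ) (b' δ)),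
          Q.map Prod.fst = SAW.brickWallLaw E.carrier δ 0 (a δ) (b δ) ∧
          Q.map Prod.snd = SAW.embLaw hexGraph (fun v : HexVertex => B (hexCenter v)) E.carrier δ
            SAW.hexCriticalFugacity (a' δ) (b' δ) ∧
          Q {p | ¬ ∃ (α₁ β₁ α₂ β₂ m : List (Site 2)),
              p.1.walk.support = α₁ ++ m ++ β₁ ∧
              p.2.walk.support.map JitteredBW.site = α₂ ++ m ++ β₂ ∧
              (∀ x ∈ α₁ ++ α₂, dist (meshPoint δ x) (E.pt 0) < ρ) ∧
              (∀ x ∈ β₁ ++ β₂, dist (meshPoint δ x) (E.pt 1) < ρ)} ≤ ENNReal.ofReal ρ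

/-- The bonds on which the two conventions DISAGREE at mesh `δ` (read on brick-wall sites): `G₁` =
brick-wall bonds of the `ℤ²` discrete domain `discreteDomainGraph E δ` (the support graph of the
straight law at `t = 0`, `edges_mem_inf_brickWall_of_oddVerticalCount_eq_zero`), `G₂` = the
jittered domain graph transported along `JitteredBW.equiv`.  A site is *disputed* if some bond at
it belongs to exactly one of the two graphs. [folklore] -/
def disputedSite (B : ℂ ≃ₜ ℂ) (Ω : Set ℂ) (δ : ℝ) (x : Site 2) : Prop :=
  ∃ y : Site 2, ¬ ((discreteDomainGraph Ω δ ⊓ SAW.brickWallGraph).Adj x y ↔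
    (SAW.embDomainGraph hexGraph (fun v : HexVertex => B (hexCenter v)) Ω δ).Adj
      (JitteredBW.vertex x) (JitteredBW.vertex y))

/-- **(M2a) Disputed-collar non-hitting away from the endpoints** (both conventions): the
probability that the walk visits a disputed site at distance `≥ ρ` from both marked points tends
to `0`.  Sufficient, with the restriction bound (iii), for the MATCHED-endpoint, away-from-endpoint
part of (M2⋆); no tree name; expected from the SLE₈⸝₃ boundary exponent but unproved on every
lattice.  OPEN. [status: open] [folklore] -/
def DisputedCollarNonHitting : Prop :=
  ∀ B : ℂ ≃ₜ ℂ,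
    (∀ z : ℂ, B z = ((2 * z.re : ℝ) : ℂ) + ((2 / Real.sqrt 3 * z.im : ℝ) : ℂ) * Complex.I) →
    ∀ (E : DobrushinDomain) (a b : ℝ → Site 2) (a' b' : ℝ → HexVertex),
      SAW.IsEndpointApprox E a b →
      SAW.IsEmbEndpointApprox hexGraph (fun v : HexVertex => B (hexCenter v)) E a' b' →
      ∀ ρ : ℝ, 0 < ρ →
        Tendsto (fun δ => (SAW.brickWallLaw E.carrier δ 0 (a δ) (b δ))
            {γ | ∃ x ∈ γ.walk.support, disputedSite B E.carrier δ x ∧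
              ρ ≤ dist (meshPoint δ x) (E.pt 0) ∧ ρ ≤ dist (meshPoint δ x) (E.pt 1)})
          (nhdsWithin 0 (Set.Ioi 0)) (nhds 0) ∧
        Tendsto (fun δ => (SAW.embLaw hexGraph (fun v : HexVertex => B (hexCenter v)) E.carrier δ
              SAW.hexCriticalFugacity (a' δ) (b' δ))
            {γ | ∃ w ∈ γ.walk.support, disputedSite B E.carrier δ (JitteredBW.site w) ∧
              ρ ≤ dist (meshPoint δ (JitteredBW.site w)) (E.pt 0) ∧
              ρ ≤ dist (meshPoint δ (JitteredBW.site w)) (E.pt 1)})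
          (nhdsWithin 0 (Set.Ioi 0)) (nhds 0)

end Summit.CriticalPhenomena.SAWScalingLimit.Cruxes.ModulusUniversality.Birth

end
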